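import Summits.MatrixMultiplication.MatrixMultiplication.Theorems.ConeTensorSteepCore
import Summits.MatrixMultiplication.MatrixMultiplication.Theorems.ConeTensor
import Summits.MatrixMultiplication.MatrixMultiplication.Theorems.SaturationLadderLevelTwo
import Literature.Computability.AlgebraicComplexity.Coppersmith1982RapidRectangular
import Literature.Computability.AlgebraicComplexity.RectangularExponentAsymptoticRank
import Literature.Computability.AlgebraicComplexity.RectangularExponentSymmetry
import HarnessLib

/-!
# ConeTensorSteep — the spoke pencil `ω_steep(k)` of the steep cones `W_{n^k, n}` and its decided far
end: `ω_steep(k) = 6k` for `1/k ≤ α` (unconditionally `k ≥ 6` over every field, `k ≥ 4` over `ℂ`),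
and conversely `ω_steep(k) = 6k ⟹ α ≥ 2/(3k)`

(decomp-mm lens 6 «barrier-complement carving», gen 34; a Theorems kernel beneath the attacked leaf
`TetrahedronCarving.TetraExcessZero` (stmt-26697), filed `--as helper`: negative/structural knowledge
for its IDEA-NEEDED specification, not a stub of its registered line. The tensor `W_{N,n}`
(`steep`), its cover, grouping and floor are in `ConeTensorSteepCore`.)

THE SPOKE PENCIL. Along `N = n^k` (`k = j + 1 ≥ 1`; spokes `n^{2k}`, rim `n`) the exponent
`ω_steep(k) = inf {β | R₄(W_{n^k, n}) = O(n^β)}` (`omegaSteep F j`) satisfies, over every field,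

  `6k = ω(4k, 2, 2k)|_flat ≤ ω(4k, 2, 2k) ≤ ω_steep(k) ≤ 3·ω(k, 1, k) = 3k·ω(1, 1/k, 1) ≤ 9k`

(grouping `{2,3} | 0 | 1` is EXACTLY `⟨N⁴, n², N²⟩`; cover by the three apex triangles), hence

  ★ `ω_steep(k) = 6k` as soon as `1/k ≤ α` (`omegaSteep_eq_of_inv_le_dualExponentAlpha`):
    unconditionally for `k ≥ 6` over EVERY field (Coppersmith 1982, tree theorem
    `coppersmith1982_dualExponentAlpha_gt : 0.1722 < α`), and for `k ≥ 4` over `ℂ` (tree theorem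
    `alpha_ge_3_10 : 3/10 ≤ α(ℂ)`, SaturationLadderLevelTwo);
  ★ conversely `ω_steep(k) = 6k ⟹ 2/(3k) ≤ α` (`le_dualExponentAlpha_of_steepFlat`: the grouping is
    then flat, `ω(2,1/k,1) = ω(1,1/k,2) = 3`, and Lotti–Romani subadditivity + homogeneity give
    `ω(1, 2/(3k), 1) = 2`; at `k = 1` this is the tree's `ConeFlat ⟹ α ≥ 2/3`).
  So the pencil's flatness threshold `k⋆(F) = min {k | ω_steep(k) = 6k}` is pinned to
  `2/(3α) ≤ k⋆ ≤ ⌈1/α⌉` (`spokePencil_sandwich`), flatness propagates upward from `k` to every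
  `k' ≥ 3k/2` (`omegaSteep_eq_of_steepFlat_of_le`), `k⋆ ≤ 6` over every field, `k⋆ ≤ 4` over `ℂ`,
  and `k⋆ = 1 ⟺ ConeFlat` (one half of the exact cut `ω = 2`).

So the far end of the spoke pencil is DECIDED (flattening-tight, by three Coppersmith-flat triangles
whose cheap direction points at the hub: their vertex cuts at `0` add up to the apex cut `0 | 123` of
the cone — an ALIGNED flat cover), while its near end carries exact cuts of the summit: `k = 1` is the
cone `W_n` (`ConeTensor.matrixMultiplication_iff_cone`; `ConeFlat ⟹ α ≥ 2/3`), and the uniform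
tetrahedron (`spokes = rim`) is `TetrahedronCarving` (`TetraFlat ⟹ α ≥ 1/2`). Reproduced here at
`j = 0`: `6 ≤ ω_steep(1) ≤ 3ω` and `ω(ℂ) = 2 ⟺ [ω_steep(1) ≤ 6] ∧ [3ω ≤ ω_steep(1)]`.

READING FOR THE LEAF (why `TetraExcessZero` is IDEA-NEEDED and the steep cones are not). Absorbing a
light edge is FREE whenever a Coppersmith-flat piece can host it inside a cover whose pieces' optimal
cuts align with a max cut of the profile (here: rim edges of relative weight `1/k ≤ α` inside the apex
triangles). The sixth-edge rung of the leaf (`EdgePencilSixthLadder.SixRungPos`: a light edge `01` of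
weight `δ` on the diamond `K₄ − 01` costs nothing, `χ(δ) = ψ`) asks for the same absorption over a base
whose flatness is itself open (`ψ = 4 ⟺ α ≥ 1/2`, `EdgePencilCollapse`), where no aligned flat cover
exists unless `α ≥ 1/2` (`EdgePencilReroutingCover.halfAlpha_of_placedCoverCertificate`). The steep
cones are the decided siblings on the star side `0 | 123` of that dichotomy; the leaf sits on the
`01 | 23` side.

What is proved (every field unless marked `ℂ`; no `sorry`, no new axiom, no instance, no notation, no
`Prop`-valued definition): the exponent layer `omegaRect_le_omegaSteep`, `six_mul_le_omegaSteep`,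
`omegaSteep_le_cover`, `omegaRect_apex_eq`, `omegaSteep_bracket`, ★
`omegaSteep_eq_of_inv_le_dualExponentAlpha`, `omegaSteep_eq_of_six_le` (every field),
`omegaSteep_complex_eq_of_four_le` (`ℂ`), `omegaSteep_eq_of_matrixMultiplication` (all `k`, under
`ω = 2`); the converse ★ `le_dualExponentAlpha_of_steepFlat`, `spokePencil_sandwich`,
`omegaSteep_eq_of_steepFlat_of_le`; and the `j = 0` cut `matrixMultiplication_iff_steep_zero`,
`spokePencil_chart`.
-/

noncomputable section

-- D-0017 nested layout `Summits/<Summit>/<Sub>/…` with `Sub = Summit` duplicates a namespace component.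
set_option linter.dupNamespace false

open scoped BigOperators
open Filter Asymptotics Module
open Literature.Computability.AlgebraicComplexity
open Summit.MatrixMultiplication.MatrixMultiplication.Theorems.TetrahedronTensor

namespace Summit.MatrixMultiplication.MatrixMultiplication.Theorems.ConeTensor

/-! ## The spoke pencil in exponents: `ω_steep(k)`, `k = j + 1` (spokes `n^{2k}`, rim `n`) -/

section Exponent

variable (F : Type) [Field F]

/-- Admissible exponents of the steep family `n ↦ steep F n (n^j)` (`N = n^{j+1}`: spokes `n^{2(j+1)}`,
rim `n`). (CVZ19 Def. 1.1.13, non-uniform dimensions as in Ex. 1.1.2). -/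
def steepAdmissibleExponents (j : ℕ) : Set ℝ :=
  {β : ℝ | (fun n : ℕ => (tensorRankD (steep F n (n ^ j)) : ℝ)) =O[atTop] fun n : ℕ => (n : ℝ) ^ β}

/-- **The steep exponents** `ω_steep(j+1) = inf {β | R₄(steep F n (n^j)) = O(n^β)}` — the spoke pencil
`k = j + 1 ↦` (spokes `n^{2k}`, rim `n`) at integer steepness; `k = 1` is the squared-spoke cone.
(CVZ19 Def. 1.1.25). -/
def omegaSteep (j : ℕ) : ℝ :=
  sInf (steepAdmissibleExponents F j)

/-- Grouping: admissible for the steep family ⟹ admissible for `⟨n^{4k}, n², n^{2k}⟩`, `k = j+1`.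
[folklore] -/
theorem steepAdmissibleExponents_subset_rect (j : ℕ) :
    steepAdmissibleExponents F j ⊆
      rectAdmissibleExponents F (4 * ((j : ℝ) + 1)) 2 (2 * ((j : ℝ) + 1)) := by
  intro β hβ
  refine IsBigO.trans ?_ hβ
  refine IsBigO.of_bound 1 ?_
  filter_upwards [eventually_ge_atTop 1] with n hn
  rw [one_mul, Real.norm_of_nonneg (Nat.cast_nonneg _), Real.norm_of_nonneg (Nat.cast_nonneg _)]
  haveI : NeZero n := ⟨by omega⟩
  haveI : NeZero (n ^ j) := ⟨pow_ne_zero j (NeZero.ne n)⟩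
  have h1 : rectDim n (4 * ((j : ℝ) + 1)) = (n * n ^ j) * (n * n ^ j) * ((n * n ^ j) * (n * n ^ j)) := by
    rw [show (4 * ((j : ℝ) + 1)) = ((4 * (j + 1) : ℕ) : ℝ) by push_cast; ring, rectDim_natCast]
    ring
  have h2 : rectDim n 2 = n * n := by
    rw [show (2 : ℝ) = ((2 : ℕ) : ℝ) by norm_num, rectDim_natCast, pow_two]
  have h3 : rectDim n (2 * ((j : ℝ) + 1)) = (n * n ^ j) * (n * n ^ j) := by
    rw [show (2 * ((j : ℝ) + 1)) = ((2 * (j + 1) : ℕ) : ℝ) by push_cast; ring, rectDim_natCast]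
    ring
  rw [tensorRank_matMulTensor_congr F h1 h2 h3]
  exact_mod_cast tensorRank_matMulTensor_le_tensorRankD_steep (F := F) n (n ^ j)

/-- The admissible exponents of the steep family are bounded below (grouping). -/
theorem steepAdmissibleExponents_bddBelow (j : ℕ) : BddBelow (steepAdmissibleExponents F j) :=
  (rectAdmissibleExponents_bddBelow F _ 2 _).mono (steepAdmissibleExponents_subset_rect F j)

/-- **The cover in admissible exponents**: `β` admissible for `(k, 1, k)` ⟹ `3β` admissible for the
steep family, `k = j + 1` (`R₄(W_{n^k,n}) ≤ R(⟨n^k, n, n^k⟩)³`). [cite: ChristandlVranaZuiddam2016, Prop. 1.1.16] -/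
theorem mem_steepAdmissibleExponents_of_cover {j : ℕ} {β : ℝ}
    (hβ : β ∈ rectAdmissibleExponents F ((j : ℝ) + 1) 1 ((j : ℝ) + 1)) :
    3 * β ∈ steepAdmissibleExponents F j := by
  obtain ⟨C, hC0, hC⟩ := isBigO_iff'.1 hβ
  refine IsBigO.of_bound (C ^ 3) ?_
  filter_upwards [hC] with n hn
  rw [Real.norm_of_nonneg (Nat.cast_nonneg _),
    Real.norm_of_nonneg (Real.rpow_nonneg (Nat.cast_nonneg _) _)] at hn ⊢
  have hn0 : (0 : ℝ) ≤ n := Nat.cast_nonneg _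
  have hpow : ((n : ℝ) ^ β) ^ 3 = (n : ℝ) ^ (3 * β) := by
    rw [← Real.rpow_natCast ((n : ℝ) ^ β) 3, ← Real.rpow_mul hn0]
    congr 1
    push_cast
    ring
  have h1 : rectDim n ((j : ℝ) + 1) = n * n ^ j := by
    rw [show ((j : ℝ) + 1) = ((j + 1 : ℕ) : ℝ) by push_cast; ring, rectDim_natCast, pow_succ']
  rw [tensorRank_matMulTensor_congr F h1 (rectDim_one n) h1] at hn
  calc (tensorRankD (steep F n (n ^ j)) : ℝ)
      ≤ ((tensorRank (matMulTensor F (n * n ^ j) n (n * n ^ j)) : ℕ) : ℝ) ^ 3 := by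
        exact_mod_cast tensorRankD_steep_le (F := F) n (n ^ j)
    _ ≤ (C * (n : ℝ) ^ β) ^ 3 := pow_le_pow_left₀ (Nat.cast_nonneg _) hn 3
    _ = C ^ 3 * (n : ℝ) ^ (3 * β) := by rw [mul_pow, hpow]

/-- The admissible exponents of the steep family are nonempty (cover). -/
theorem steepAdmissibleExponents_nonempty (j : ℕ) : (steepAdmissibleExponents F j).Nonempty := by
  obtain ⟨β, hβ⟩ := rectAdmissibleExponents_nonempty F ((j : ℝ) + 1) 1 ((j : ℝ) + 1)
  exact ⟨3 * β, mem_steepAdmissibleExponents_of_cover F hβ⟩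

/-- **Grouping floor in exponents** `ω(4k, 2, 2k) ≤ ω_steep(k)`, `k = j + 1`. [folklore] -/
theorem omegaRect_le_omegaSteep (j : ℕ) :
    omegaRect F (4 * ((j : ℝ) + 1)) 2 (2 * ((j : ℝ) + 1)) ≤ omegaSteep F j :=
  csInf_le_csInf (rectAdmissibleExponents_bddBelow F _ 2 _) (steepAdmissibleExponents_nonempty F j)
    (steepAdmissibleExponents_subset_rect F j)

/-- **Flattening floor in exponents** `6k ≤ ω_steep(k)`, `k = j + 1` (information bound
`4k + 2k ≤ ω(4k, 2, 2k)`: the apex cut `0 | 123`). [cite: ChristandlVranaZuiddam2016, §1.2 (eq. (flat))] -/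
theorem six_mul_le_omegaSteep (j : ℕ) : 6 * ((j : ℝ) + 1) ≤ omegaSteep F j := by
  have h := add_le_omegaRect₁₃ F (4 * ((j : ℝ) + 1)) 2 (2 * ((j : ℝ) + 1))
  have h' := omegaRect_le_omegaSteep F j
  linarith

/-- **The apex-triangle cover in exponents** `ω_steep(k) ≤ 3·ω(k, 1, k)`, `k = j + 1`.
[cite: ChristandlVranaZuiddam2016, Prop. 1.1.16] -/
theorem omegaSteep_le_cover (j : ℕ) :
    omegaSteep F j ≤ 3 * omegaRect F ((j : ℝ) + 1) 1 ((j : ℝ) + 1) := by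
  have h : ∀ β ∈ rectAdmissibleExponents F ((j : ℝ) + 1) 1 ((j : ℝ) + 1), omegaSteep F j / 3 ≤ β :=
    fun β hβ => by
    have := csInf_le (steepAdmissibleExponents_bddBelow F j) (mem_steepAdmissibleExponents_of_cover F hβ)
    change omegaSteep F j ≤ 3 * β at this
    linarith
  have h3 : omegaSteep F j / 3 ≤ omegaRect F ((j : ℝ) + 1) 1 ((j : ℝ) + 1) :=
    le_csInf (rectAdmissibleExponents_nonempty F _ _ _) h
  linarith

/-- Homogeneity of the apex triangle: `ω(k, 1, k) = k·ω(1, 1/k, 1)`, `k = j + 1`.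
[cite: LottiRomani1983, §1 (p. 173)] -/
theorem omegaRect_apex_eq (j : ℕ) :
    omegaRect F ((j : ℝ) + 1) 1 ((j : ℝ) + 1) =
      ((j : ℝ) + 1) * omegaRect F 1 (1 / ((j : ℝ) + 1)) 1 := by
  have hk : (0 : ℝ) < (j : ℝ) + 1 := by positivity
  have h := omegaRect_smul F (t := j + 1) (by omega) (a := 1) (b := 1 / ((j : ℝ) + 1)) (c := 1)
    zero_le_one (by positivity) zero_le_one
  push_cast at h
  rw [mul_one, mul_one_div_cancel hk.ne'] at h
  exact h

/-- **The spoke pencil bracket** `6k ≤ ω_steep(k) ≤ 3k·ω(1, 1/k, 1)`, `k = j + 1`, over every field.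
[cite: ChristandlVranaZuiddam2016, §1.2 and Prop. 1.1.16] -/
theorem omegaSteep_bracket (j : ℕ) :
    6 * ((j : ℝ) + 1) ≤ omegaSteep F j ∧
      omegaSteep F j ≤ 3 * (((j : ℝ) + 1) * omegaRect F 1 (1 / ((j : ℝ) + 1)) 1) := by
  refine ⟨six_mul_le_omegaSteep F j, ?_⟩
  rw [← omegaRect_apex_eq F j]
  exact omegaSteep_le_cover F j

/-- ★ **The far end of the spoke pencil is decided**: if `1/k ≤ α` (the rim is Coppersmith-light
relative to the spokes) then `ω_steep(k) = 6k` — the steep cone is flattening-tight, by the ALIGNED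
flat cover (three apex triangles `⟨n^k, n, n^k⟩` of exponent `2k` each, whose cheap vertex cuts at
the hub add up to the apex cut). [cite: Coppersmith1982, Theorem] [cite: LeGall2012, §1 (ω(1,1,k) = 2 ↔ k ≤ α)] -/
theorem omegaSteep_eq_of_inv_le_dualExponentAlpha {j : ℕ}
    (hα : 1 / ((j : ℝ) + 1) ≤ dualExponentAlpha F) :
    omegaSteep F j = 6 * ((j : ℝ) + 1) := by
  have hflat : omegaRect F 1 (1 / ((j : ℝ) + 1)) 1 = 2 :=
    (omegaRect_eq_two_iff_le_dualExponentAlpha F _).2 hα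
  obtain ⟨hlo, hhi⟩ := omegaSteep_bracket F j
  rw [hflat] at hhi
  refine le_antisymm ?_ hlo
  linarith

/-- ★ **Unconditional flatness for `k ≥ 6` over EVERY field**: `ω_steep(k) = 6k` (`1/k ≤ 1/6 <
0.1722 < α`, Coppersmith 1982 at kernel grade). [cite: Coppersmith1982, Theorem] [cite: BurgisserClausenShokrollahi1997, Thm. (15.51)] -/
theorem omegaSteep_eq_of_six_le {j : ℕ} (hj : 6 ≤ j + 1) :
    omegaSteep F j = 6 * ((j : ℝ) + 1) := by
  refine omegaSteep_eq_of_inv_le_dualExponentAlpha F ?_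
  have hk : (6 : ℝ) ≤ (j : ℝ) + 1 := by exact_mod_cast hj
  have h6 : 1 / ((j : ℝ) + 1) ≤ 1 / 6 := one_div_le_one_div_of_le (by norm_num) hk
  have hα := coppersmith1982_dualExponentAlpha_gt (K := F)
  linarith

/-- ★ **Over `ℂ`, flatness for `k ≥ 4`**: `ω_steep(k) = 6k` (`1/k ≤ 1/4 < 3/10 ≤ α(ℂ)`, the tree's
saturation-ladder theorem `alpha_ge_3_10`). [cite: LeGall2012, Thm. 1.1] [cite: Coppersmith1997, §3] -/
theorem omegaSteep_complex_eq_of_four_le {j : ℕ} (hj : 4 ≤ j + 1) :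
    omegaSteep ℂ j = 6 * ((j : ℝ) + 1) := by
  refine omegaSteep_eq_of_inv_le_dualExponentAlpha ℂ ?_
  have hk : (4 : ℝ) ≤ (j : ℝ) + 1 := by exact_mod_cast hj
  have h4 : 1 / ((j : ℝ) + 1) ≤ 1 / 4 := one_div_le_one_div_of_le (by norm_num) hk
  have hα := SaturationLadderLevelTwo.alpha_ge_3_10
  linarith

/-- **Under `ω(ℂ) = 2` the whole pencil is flat**: `ω_steep(k) = 6k` for every `k ≥ 1` (`α = 1`).
[cite: ChristandlVranaZuiddam2016, §1.3] -/
theorem omegaSteep_eq_of_matrixMultiplication (hS : _root_.MatrixMultiplication) (j : ℕ) :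
    omegaSteep ℂ j = 6 * ((j : ℝ) + 1) := by
  refine omegaSteep_eq_of_inv_le_dualExponentAlpha ℂ ?_
  have hω : omega ℂ = 2 := (_root_.MatrixMultiplication_iff).1 hS
  have hα : dualExponentAlpha ℂ = 1 := (dualExponentAlpha_eq_one_iff ℂ).2 hω
  rw [hα]
  have hk : (1 : ℝ) ≤ (j : ℝ) + 1 := by
    have : (0 : ℝ) ≤ (j : ℝ) := Nat.cast_nonneg j
    linarith
  exact (div_le_one (by positivity)).2 hk

/-! ## The converse direction: a flat steep cone forces `α ≥ 2/(3k)` -/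

/-- `ω_steep(k) ≤ 6k ⟺ ω_steep(k) = 6k` (flattening floor). -/
theorem omegaSteep_le_iff_eq (j : ℕ) :
    omegaSteep F j ≤ 6 * ((j : ℝ) + 1) ↔ omegaSteep F j = 6 * ((j : ℝ) + 1) :=
  ⟨fun h => le_antisymm h (six_mul_le_omegaSteep F j), fun h => h.le⟩

/-- **A flat steep cone flattens its grouping**: `ω_steep(k) ≤ 6k ⟹ ω(2, 1/k, 1) = 3` (grouping floor
`ω(4k,2,2k) ≤ ω_steep(k)`, homogeneity `ω(4k,2,2k) = 2k·ω(2,1/k,1)`, information bound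
`3 ≤ ω(2,1/k,1)`). [cite: LottiRomani1983, §1 (p. 173)] -/
theorem omegaRect_two_inv_one_eq_three_of_steepFlat {j : ℕ}
    (h : omegaSteep F j ≤ 6 * ((j : ℝ) + 1)) :
    omegaRect F 2 (1 / ((j : ℝ) + 1)) 1 = 3 := by
  have hk : (0 : ℝ) < (j : ℝ) + 1 := by positivity
  have hgrp := omegaRect_le_omegaSteep F j
  have hhom : omegaRect F (4 * ((j : ℝ) + 1)) 2 (2 * ((j : ℝ) + 1)) =
      (2 * ((j : ℝ) + 1)) * omegaRect F 2 (1 / ((j : ℝ) + 1)) 1 := by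
    have hh := LottiRomani1983_homogeneous F (ν := 2 * ((j : ℝ) + 1)) (x := 2)
      (y := 1 / ((j : ℝ) + 1)) (z := 1) (by positivity) (by norm_num) (by positivity) (by norm_num)
    have e1 : 2 * ((j : ℝ) + 1) * 2 = 4 * ((j : ℝ) + 1) := by ring
    have e2 : 2 * ((j : ℝ) + 1) * (1 / ((j : ℝ) + 1)) = 2 := by field_simp
    have e3 : 2 * ((j : ℝ) + 1) * 1 = 2 * ((j : ℝ) + 1) := by ring
    rw [e1, e2, e3] at hh
    exact hh
  have hlow := add_le_omegaRect₁₃ F 2 (1 / ((j : ℝ) + 1)) 1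
  have hup : (2 * ((j : ℝ) + 1)) * omegaRect F 2 (1 / ((j : ℝ) + 1)) 1 ≤ (2 * ((j : ℝ) + 1)) * 3 := by
    rw [← hhom]; linarith
  have hup' : omegaRect F 2 (1 / ((j : ℝ) + 1)) 1 ≤ 3 := le_of_mul_le_mul_left hup (by positivity)
  linarith

/-- **A flat steep cone forces `α ≥ 2/(3k)`**: `ω(2,1/k,1) = ω(1,1/k,2) = 3` (symmetry), so
`ω(3, 2/k, 3) ≤ 6` (Lotti–Romani subadditivity), i.e. `ω(1, 2/(3k), 1) ≤ 2` (homogeneity), hence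
`2/(3k) ≤ α`. At `k = 1` this is the tree's `ConeFlat ⟹ α ≥ 2/3`
(`twoThirds_le_dualExponentAlpha_of_omegaCone_le_six`, same argument). [cite: LottiRomani1983, §1 (p. 173)] -/
theorem le_dualExponentAlpha_of_steepFlat {j : ℕ} (h : omegaSteep F j ≤ 6 * ((j : ℝ) + 1)) :
    2 / (3 * ((j : ℝ) + 1)) ≤ dualExponentAlpha F := by
  have hk : (0 : ℝ) < (j : ℝ) + 1 := by positivity
  set b : ℝ := 1 / ((j : ℝ) + 1) with hb
  have hb0 : 0 ≤ b := by positivity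
  have hb1 : b ≤ 1 := (div_le_one hk).2 (by linarith [(Nat.cast_nonneg j : (0 : ℝ) ≤ j)])
  have h213 : omegaRect F 2 b 1 = 3 := omegaRect_two_inv_one_eq_three_of_steepFlat F h
  have h112 : omegaRect F 1 b 2 = 3 := by rw [← omegaRect_swap₁₃ F 2 b 1]; exact h213
  have hsub := LottiRomani1983_subadditive F 2 b 1 1 b 2
  have hhom : omegaRect F (2 + 1) (b + b) (1 + 2) = 3 * omegaRect F 1 (2 / 3 * b) 1 := by
    have hh := LottiRomani1983_homogeneous F (ν := 3) (x := 1) (y := 2 / 3 * b) (z := 1)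
      (by norm_num) (by norm_num) (by positivity) (by norm_num)
    have e2 : (3 : ℝ) * (2 / 3 * b) = b + b := by ring
    rw [e2] at hh
    rw [show (2 : ℝ) + 1 = 3 * 1 by norm_num, show (1 : ℝ) + 2 = 3 * 1 by norm_num]
    exact hh
  have hlow := add_le_omegaRect₁₃ F 1 (2 / 3 * b) 1
  have htwo : omegaRect F 1 (2 / 3 * b) 1 = 2 := by
    refine le_antisymm ?_ (by linarith)
    have : 3 * omegaRect F 1 (2 / 3 * b) 1 ≤ 3 * 2 := by rw [← hhom]; linarith
    linarith
  have hα := le_dualExponentAlpha (K := F) (a := 2 / 3 * b) ⟨by positivity, by linarith⟩ htwo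
  have e : 2 / (3 * ((j : ℝ) + 1)) = 2 / 3 * b := by rw [hb]; field_simp
  rw [e]
  exact hα

/-- ★ **The spoke-pencil sandwich** (every field, every `k = j + 1 ≥ 1`):
`1/k ≤ α ⟹ ω_steep(k) = 6k ⟹ 2/(3k) ≤ α`. So the flatness threshold
`k⋆(F) = min {k | ω_steep(k) = 6k}` satisfies `2/(3α) ≤ k⋆ ≤ ⌈1/α⌉` (`k⋆ ≤ 6` over every field,
`k⋆ ≤ 4` over `ℂ`; `k⋆ = 1 ⟺ ConeFlat`, which is one half of the exact cut `ω = 2`).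
[cite: Coppersmith1982, Theorem] [cite: LottiRomani1983, §1 (p. 173)] -/
theorem spokePencil_sandwich (j : ℕ) :
    (1 / ((j : ℝ) + 1) ≤ dualExponentAlpha F → omegaSteep F j = 6 * ((j : ℝ) + 1)) ∧
      (omegaSteep F j = 6 * ((j : ℝ) + 1) → 2 / (3 * ((j : ℝ) + 1)) ≤ dualExponentAlpha F) :=
  ⟨fun h => omegaSteep_eq_of_inv_le_dualExponentAlpha F h,
    fun h => le_dualExponentAlpha_of_steepFlat F h.le⟩

/-- **Flatness propagates up the pencil** (through `α`): if the `k`-th steep cone is flat then so is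
every `k'`-th with `k' ≥ 3k/2`. [cite: LottiRomani1983, §1 (p. 173)] -/
theorem omegaSteep_eq_of_steepFlat_of_le {j j' : ℕ} (h : omegaSteep F j ≤ 6 * ((j : ℝ) + 1))
    (hjj : 3 * ((j : ℝ) + 1) ≤ 2 * ((j' : ℝ) + 1)) :
    omegaSteep F j' = 6 * ((j' : ℝ) + 1) := by
  refine omegaSteep_eq_of_inv_le_dualExponentAlpha F (le_trans ?_ (le_dualExponentAlpha_of_steepFlat F h))
  have hk : (0 : ℝ) < (j : ℝ) + 1 := by positivity
  have hk' : (0 : ℝ) < (j' : ℝ) + 1 := by positivity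
  rw [div_le_div_iff₀ hk' (by positivity)]
  linarith

/-! ## The near end `k = 1` (`j = 0`, spokes `n²`, rim `n`: the squared-spoke cone) carries the cut -/

/-- At `j = 0` the bracket is the cone's: `6 ≤ ω_steep(1) ≤ 3ω`. [cite: ChristandlVranaZuiddam2016, Prop. 1.1.16] -/
theorem omegaSteep_zero_bracket : 6 ≤ omegaSteep F 0 ∧ omegaSteep F 0 ≤ 3 * omega F := by
  obtain ⟨hlo, -⟩ := omegaSteep_bracket F 0
  have hhi := omegaSteep_le_cover F 0
  norm_num at hlo hhi
  rw [omegaRect_one_one_one] at hhi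
  exact ⟨hlo, hhi⟩

/-- **The `k = 1` member carries an exact cut of the summit** (as `ConeTensor.matrixMultiplication_iff_cone`):
`ω(ℂ) = 2 ⟺ [ω_steep(1) ≤ 6] ∧ [3ω ≤ ω_steep(1)]`. [cite: ChristandlVranaZuiddam2016, §1.3] -/
theorem matrixMultiplication_iff_steep_zero :
    _root_.MatrixMultiplication ↔ (omegaSteep ℂ 0 ≤ 6 ∧ 3 * omega ℂ ≤ omegaSteep ℂ 0) := by
  obtain ⟨hlo, hhi⟩ := omegaSteep_zero_bracket ℂ
  constructor
  · intro hS
    have hω : omega ℂ = 2 := (_root_.MatrixMultiplication_iff).1 hS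
    rw [hω] at hhi ⊢
    constructor <;> linarith
  · rintro ⟨hA, hB⟩
    refine (_root_.MatrixMultiplication_iff).2 (le_antisymm ?_ (omega_two_le ℂ))
    linarith

/-- **The pencil dichotomy in one statement** (over `ℂ`): the steep cones are flat from `k = 4` on,
unconditionally, while flatness of the `k = 1` member is (one half of) an exact cut of `ω = 2`.
[cite: LeGall2012, Thm. 1.1] [cite: ChristandlVranaZuiddam2016, §1.3] -/
theorem spokePencil_chart :
    (∀ j : ℕ, 4 ≤ j + 1 → omegaSteep ℂ j = 6 * ((j : ℝ) + 1)) ∧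
      (_root_.MatrixMultiplication ↔ (omegaSteep ℂ 0 ≤ 6 ∧ 3 * omega ℂ ≤ omegaSteep ℂ 0)) :=
  ⟨fun _ hj => omegaSteep_complex_eq_of_four_le hj, matrixMultiplication_iff_steep_zero⟩

end Exponent

end Summit.MatrixMultiplication.MatrixMultiplication.Theorems.ConeTensor

end
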